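import Mathlib
import HarnessLib
import HarnessLib.Audit
import Summits.AtomisticToContinuum.Statement
import Literature.MathematicalPhysics.StatisticalMechanics.LennardJonesClusters

/-!
Route: BenjaminiSchrammGroundStates

CLOSED (retired) 2026-08-15T13:41:08Z by operator:999:1257524 — reason: not-a-thesis: assembly does not conclude the sub-problem Statement — note: D-0027 §2.1 audit (human 2026-08-15: routes that do not decide the summit are removed): the assembly concludes `Literature.MathematicalPhysics.StatisticalMechanics.Crystallization`, not the sub-problem statement; a NEW conforming route may be opened from the same idea (generated `closes : … → _root_. The file is kept as the record of this route; refuted decls are indexed as negative knowledge (`ledger negatives`).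

# Route BenjaminiSchrammGroundStates — Benjamini–Schramm limits of LJ ground states: crystallization
as a support statement about stationary energy minimisers; attainment for free by surgery

It suffices to show X := (iii) ∧ NoFoam, realising card benjamini-schramm-ground-states
(ideator-10):
(iii) StationaryMinimisersChargePeriodic — every translation-invariant probability law on hard-core,
relatively dense point
configurations of ℝ³ whose Lennard-Jones energy per particle equals the periodic infimum e* = ⨅_Q
e(Q) charges, at every
scale (R, ε), the local neighbourhood of ONE periodic configuration Q (a support statement about
zero-temperature Gibbs /
ground-state measures in Radin's sense, infinite volume from the start); and
NoFoam — in N-particle LJ ground states the fraction of particles within distance R of an empty ball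
of radius r₀ tends to 0
for every R (cohesion: the Benjamini–Schramm limit is the Palm version of a stationary law of
positive intensity).
Given X, the exact mass-transport identity E(N)/N = E_(P_N)[h] of the particle-rooted empirical
fields, compactness, Palm
inversion and E(N)/N → e* (bookkeeping 0626) give the finite-N hinge GroundStatesChargePeriodic
(support BSLimitGlue); the
surgery lemma ChargedPeriodicIsOptimal turns "Q is charged with positive density" into "e(Q) =
min_Q' e(Q')" (conjunct (i),
attainment, without identifying the minimiser), and ChargedPatternCrystallizes extracts the
translated subsequence of (ii).
Lean: `(∀ δ₀ r₀ : ℝ, 0 < δ₀ → 0 < r₀ → ∀ P : MeasureTheory.Measure (MeasureTheory.Measure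
(EuclideanSpace ℝ (Fin 3))), MeasureTheory.IsProbabilityMeasure P → (∀ᵐ μ ∂P, ∃ S : Set
(EuclideanSpace ℝ (Fin 3)), (∀ x ∈ S, ∀ y ∈ S, x ≠ y → δ₀ ≤ dist x y) ∧ μ =
MeasureTheory.Measure.sum (fun s : S => MeasureTheory.Measure.dirac (s : EuclideanSpace ℝ (Fin 3))))
→ (∀ᵐ μ ∂P, ∀ c : EuclideanSpace ℝ (Fin 3), ∃ y : EuclideanSpace ℝ (Fin 3), μ {y} ≠ 0 ∧ dist y c ≤
r₀) → (∀ (v : EuclideanSpace ℝ (Fin 3)) (A : Set (MeasureTheory.Measure (EuclideanSpace ℝ (Fin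
3)))), MeasurableSet A → P {μ | μ.map (· + v) ∈ A} = P A) → (∫ μ, (∑' p : {p : EuclideanSpace ℝ (Fin
3) × EuclideanSpace ℝ (Fin 3) // μ {p.1} ≠ 0 ∧ μ {p.2} ≠ 0 ∧ p.1 ∈ Metric.closedBall (0 :
EuclideanSpace ℝ (Fin 3)) 1 ∧ p.1 ≠ p.2},
Literature.MathematicalPhysics.StatisticalMechanics.lennardJones (dist p.1.1 p.1.2)) ∂P) = 2 * (∫ μ,
(μ (Metric.closedBall (0 : EuclideanSpace ℝ (Fin 3)) 1)).toReal ∂P) * (⨅ Q :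
Literature.MathematicalPhysics.StatisticalMechanics.PeriodicConfiguration 3, Q.energyPerParticle
Literature.MathematicalPhysics.StatisticalMechanics.lennardJones) → ∃ Q :
Literature.MathematicalPhysics.StatisticalMechanics.PeriodicConfiguration 3, ∀ R ε : ℝ, 0 < R → 0 <
ε → 0 < P {μ | ∃ v : EuclideanSpace ℝ (Fin 3), (∀ s ∈ Q.points, dist s 0 ≤ R → ∃ y : EuclideanSpace
ℝ (Fin 3), μ {y} ≠ 0 ∧ dist y (s + v) ≤ ε) ∧ (∀ y : EuclideanSpace ℝ (Fin 3), μ {y} ≠ 0 → dist y v ≤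
R → ∃ s ∈ Q.points, dist y (s + v) ≤ ε)}) ∧ (∃ r₀ : ℝ, 0 < r₀ ∧ ∀ R : ℝ, 0 < R → ∀ x : (N : ℕ) →
(Fin N → EuclideanSpace ℝ (Fin 3)), (∀ N,
Literature.MathematicalPhysics.StatisticalMechanics.IsGroundState
Literature.MathematicalPhysics.StatisticalMechanics.lennardJones (x N)) → Filter.Tendsto (fun N : ℕ
=> (Nat.card {i : Fin N // ∃ c : EuclideanSpace ℝ (Fin 3), dist c (x N i) ≤ R ∧ ∀ j : Fin N, r₀ ≤
dist c (x N j)} : ℝ) / N) Filter.atTop (nhds 0))`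

## Assembly
Pure logic over the items plus two PROVED Literature facts, checked in the planner's Sketch.lean
(`assembly_provable`): BSLimitGlue applied to the two cruxes of X and to the energy limit gives the
hinge GroundStatesChargePeriodic; LennardJonesGroundStatesExist_holds supplies a ground-state
sequence, the hinge a charged periodic Q; ChargedPeriodicIsOptimal gives `IsLeast (range e) (e Q)`;
ChargedPatternCrystallizes with LennardJonesMinimalDistance_holds gives `IsCrystallizing
lennardJones 3`; with the energy limit,
`Literature.StatMech.crystallization_of_isLeast_tendsto_isCrystallizing`
(Theorems/CrystalLocalRigidityAssembly, proves 0622) yields the conjunct. The sub-problem constant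
`Crystallization` (Summits/AtomisticToContinuum/Crystallization/Statement.lean) is an abbrev of the
Literature statement targeted here.

Rationale: WHY THIS LINE. Every route on this sub-problem so far (CrystalLocalRigidity, CrystalKissingRigidity)
fights the surface at finite N (E(N) ≥ Ne* − CN^(2/3), o(N) defect counts, ≤ K fault planes); this
line passes to infinite volume ONCE and exactly: rooting x^N at a uniform particle gives laws P_N
satisfying the mass-transport principle identically with E_(P_N)[h] = E(N)/N (AldousSteele2004
objective method; unimodularity of local limits, AldousLyons2007, BenjaminiSchramm1996), so every
subsequential limit is a point-stationary law with E[h] = e_∞ = e*, and — given NoFoam — the Palm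
law of a stationary point process (HevelingLast2005, LastThorisson2009, LastPenrose2017 ch. 9).
Crystallization then becomes Radin's question about ground-state measures (RadinSchulman1983,
Radin1987, Radin1991; stationary-process energy functionals at T = 0: Leble2016, Lewin2022 Def.
11/Thm 12), where stationarity, linearity of P ↦ E_P[h] and (later) ergodic/diffraction tools are
available and finite-cluster pathologies (icosahedral LJ_13, multiply twinned particles) are
invisible. Imported: probability on rooted structures (Benjamini–Schramm / unimodular limits, Palm
calculus) and the theory of ground-state measures; the finite-N content is isolated in ONE cohesion
statement (NoFoam) and the attainment conjunct (i) is obtained from a support statement by an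
R³-versus-R² surgery, which no prior route or card other than hull-exactification-cascade (H2) uses.
Negatives index: empty at filing.

RANKED CRUXES. #2 StationaryMinimisersChargePeriodic (crux) — (card item (iii)/A4, stationary form)
for all δ₀, r₀ > 0 and every probability law P on counting measures μ of ℝ³ that is (a) a.s. a sum
of unit Dirac masses on a δ₀-separated set, (b) a.s. r₀-relatively dense (every ball of radius r₀
contains a point), (c) translation invariant, and (d) energy-minimal in the Campbell form E Σ_(x ∈ μ
∩ B̄(0,1)) Σ_(y ∈ μ, y ≠ x) V_LJ(|x − y|) = 2 · E μ(B̄(0,1)) · ⨅_Q e(Q), there is a periodic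
configuration Q such that for all R, ε > 0, with positive P-probability some translate of μ is
ε-matched both ways with Q on the ball of radius R. Ergodicity is deliberately not assumed
(equivalent modulo ergodic decomposition; the natural "defect density costs energy" proofs work for
stationary laws directly). [difficulty: open-problem] (why it might fail: Potential-generic versions
are false (AperiodicTilingGroundStates; Radin 1986 two-species quasiperiodic minimisers; Sütő). For
LJ an amorphous/polytetrahedral or aperiodically stacked stationary law reaching e* kills it; the
stacking half rests on Hägg domination (J₂≈−7e−5, uncertified, item 0670).) [Radin1991,
RadinSchulman1983, Radin1987, BlancLewin2015, Lewin2022, Leble2016, AldousLyons2007]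
#3 GroundStatesChargePeriodic (crux) — (finite-N hinge; deterministic shadow of "the
Benjamini–Schramm limit of the ground states charges Q") for every sequence of LJ ground states x^N
in ℝ³ there is ONE periodic configuration Q such that for all R, ε > 0 there is ρ > 0 with, for
infinitely many N, at least ρN particles i whose R-neighbourhood x^N ∩ B_R(x_i) is ε-matched both
ways with x_i + A(Q.points − q) for some linear isometry A and some base point q ∈ Q.points (base
point in Q.points, not a fixed origin: no vertex-transitivity is forced, cf. refuter note on 0751).
Weaker than BulkDefectVanish 0751 (fraction → 1, fixed HCP): positive density, frequently in N, any
periodic Q. [deps: StationaryMinimisersChargePeriodic, NoFoam] [difficulty: XL] (why it might fail: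
Needs ONE periodic Q charged with density ≥ρ(R,ε) at every scale for infinitely many N: fails if LJ
bulk minimisers are aperiodic (Sturmian optimal Hägg words if domination fails, Hubbard-type
staircases) or form a non-closed degenerate family (periods → ∞), or if ground states are foams.)
[BlancLewin2015, FlatleyTheil2015, Radin1991, AldousSteele2004]
#4 NoFoam (crux) — (card item A1, cohesion) there is r₀ > 0 such that for every R > 0 and every
sequence of LJ ground states x^N, the fraction of particles i for which some point c with |c − x_i|
≤ R has no particle within distance r₀ tends to 0 as N → ∞. Equivalently every Benjamini–Schramm
limit is a.s. r₀-relatively dense (bounded Voronoi cells), hence the Palm law of a stationary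
process with intensity ≥ 1/|B_(r₀)| — the one finite-N input of the line. Mechanism available:
exchange of the least-bound particle (site energy h_max) with a wall position of an interior void
(site energy ≤ −k/12 for k contacts), plus deformation (closing a crack gains tail energy ∝ area).
[difficulty: L] (why it might fail: Cohesion of LJ ground states is unproved beyond the minimal
distance (BlancLewin2015 §2.2): not even diam x^N = O(N^(1/3)) is in print; a positive density of
internal voids/cracks of width ≥ 2r₀ (sponge-like minimisers) breaks it; particle exchange only
prices voids offering > |h_max| binding.) [BlancLewin2015, LastPenrose2017, HevelingLast2005,
LastThorisson2009]
#9 ChargedPeriodicIsOptimal (support) — (card item A3, SURGERY-ATTAINMENT; conjunct (i) from a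
support statement) if a periodic configuration Q is charged by some sequence of LJ ground states
with positive density at every scale (the conclusion of GroundStatesChargePeriodic for this Q), then
e(Q) is the least value of the energy per particle over all periodic configurations. Proof sketch:
if e(Q') < e(Q), pick R ≫ 1/(e(Q) − e(Q')) and ε small; along the infinitely many N with ≥ ρN good
particles select ≥ ρN/(C R³) disjoint good R-balls (hard-core packing bound, in tree), excise each
patch (n ≈ |Q ∩ B_R| particles, self-energy ≥ n e(Q) − Cεn − CR², cross terms ≥ −CR² by the r⁻⁶ tail
and LennardJonesMinimalDistance) and insert a Q'-patch of radius R − 1 with n' ≤ n particles (margin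
1 ⇒ all new cross terms ≤ 0); compare E(N') ≤ E_mod with E(M)/M → e_∞ (BlancLewin2015_8_holds,
proved) and e_∞ ≤ e(Q') (trial states, 0629): 0 ≤ k[(n' − n)(e(Q') − e_∞) − n(e(Q) − e(Q')) + CR² +
Cεn] + o(N) with k ≥ cρN/R³ is absurd for R large. No Wulff shapes, no rates. [difficulty: M]
[BlancLewin2015, AldousSteele2004]
#9 NoStationaryBeatsPeriodic (support) — (card item A2, e_uni = e*: infinite-volume periodisation)
for every δ₀ > 0 and every translation-invariant probability law P on δ₀-hard-core counting measures
of ℝ³: 2 · E μ(B̄(0,1)) · ⨅_Q e(Q) ≤ E Σ_(x ∈ μ ∩ B̄(0,1)) Σ_(y ≠ x) V_LJ(|x − y|), i.e. no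
stationary law has energy per particle below the periodic infimum (periodise the content of a large
randomly placed box with a unit empty margin, as in 0715; boundary O(L²) against volume by
Campbell). This is what makes hypothesis (d) of the rank-2 crux a MINIMALITY statement; used by its
provers, not by the assembly. [difficulty: M] [BlancLewin2015, Leble2016, Lewin2022]
#9 BSLimitGlue (support) — (the Benjamini–Schramm framework, glue of the foreseen split of
GroundStatesChargePeriodic) StationaryMinimisersChargePeriodic → NoFoam → (E(N)/N → ⨅_Q e(Q)) →
GroundStatesChargePeriodic. Proof sketch: rooted empirical fields P_N = N⁻¹ Σ_i δ_(x^N − x_i) as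
laws on counting measures; hard core δ (LennardJonesMinimalDistance_holds) ⇒ tightness/compactness
in the vague topology; h(μ) = ½ Σ_(y ≠ 0) V(|y|) is bounded continuous there, so E_P[h] = lim
E(N_j)/N_j = ⨅ e for every subsequential limit P; P is point-stationary (mass transport holds
identically at finite N); NoFoam ⇒ P-a.s. r₀-dense ⇒ Palm inversion gives a stationary probability
law with the hypotheses (a)–(d) of the rank-2 crux (Campbell); its charged Q has P_(N_j)-frequency ≥
ρ for j large (portmanteau on open pattern events), which is the hinge. [glue] [difficulty: L]
[AldousLyons2007, AldousSteele2004, BenjaminiSchramm1996, HevelingLast2005, LastThorisson2009,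
LastPenrose2017]
#9 ChargedPatternCrystallizes (support) — (soft) GroundStatesChargePeriodic →
LennardJonesMinimalDistance → IsCrystallizing lennardJones 3: choose scales (k, 1/k), indices N_k ↑
with a good particle i_k, isometries A_k → A along a subsequence (compactness of O(3)), τ_k :=
−x_(i_k) + alignment; the two-way matching with minimal distance is eventually exact near every
compact set, so PeriodicConfiguration.tendsto_sum_of_eventually_near' (in tree) gives local
convergence to the periodic configuration A(Q − q) (isometryImage/translate in
CrystallizationSymmetries), multiplicity 1. [difficulty: M] [BlancLewin2015]
#9 CrysEnergyLimit (support) — (shared item stmt-AtomisticToContinuum-0626 of CrystalLocalRigidity,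
bookkeeping: periodisation 0715 + trial states 0629 + BlancLewin2015_8_holds) E(N)/N → ⨅ over
periodic configurations of the LJ energy per particle. [difficulty: M] [BlancLewin2015]

TWO-LAYER PLAN. Foreseen split 1 (once the glue or NoFoam closes): GroundStatesChargePeriodic ⇐
StationaryMinimisersChargePeriodic → NoFoam → GroundStatesChargePeriodic, glue = BSLimitGlue with
the energy limit (already filed as support so it can be proved early).
Foreseen split 2 (once GroundStatesChargePeriodic or NoFoam closes):
StationaryMinimisersChargePeriodic ⇐ LocalBarlowAlmostSurely (minimising stationary hard-core laws
are a.s. softly twelve-coordinated with cubocta/anticubocta shells — the measure-level form of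
0750/0758, shared with card palm-unimodular-zero-pressure-limit U1) → ZeroFaultDensity (linearity of
E_P[h] + Hägg domination 0737 ⇒ fault density 0 ⇒ the hcp-type stacking is charged) →
StationaryMinimisersChargePeriodic. Nothing here is filed now.

KILL CRITERIA. An explicit translation-invariant hard-core law at energy e* charging no periodic
pattern (e.g. built from an aperiodic optimal Hägg word if the certified domination of 0670 FAILS)
refutes StationaryMinimisersChargePeriodic and closes the route (it would also sink conjunct (ii) in
substance). NoFoam refuted (sponge-like ground states) closes THIS stationary formulation → pivot to
the point-stationary (Palm-side) formulation of the sibling card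
palm-unimodular-zero-pressure-limit, where (iii) must absorb cohesion. GroundStatesChargePeriodic
refuted with (iii) standing means the glue is wrong → same pivot. Refutation of 0627 (route
RefuteCrystalPeriodicMin) kills the conjunct for every route. Mooted-by: BulkDefectVanish (0751)
proved ⇒ the hinge holds at once (fraction → 1 ⇒ density ≥ 1/2), after which only the support items
of this route are needed for the assembly.

NOT DECOMPOSED YET. The Benjamini–Schramm internals of BSLimitGlue (vague topology on hard-core
counting measures as a compact Polish space, measurability of h and of pattern events, exactness
E_(P_N)[h] = E(N)/N, Palm inversion with bounded Voronoi cells, portmanteau transfer) — one support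
item now, split only if a prover releases it exhausted; the seam constants and the disjoint-patch
selection of the surgery; rotations bookkeeping in ChargedPatternCrystallizes; the
virial/zero-pressure identities and the pair-statistics rigidity of the sibling palm card (not
needed for this assembly); a reusable Literature point-process interface (HardCorePointProcess /
IsStationary / intensity / palmEnergy / Charges): all statements are typed INLINE over `Measure
(Measure (EuclideanSpace ℝ (Fin 3)))` today and can be re-expressed by set-signature when such
definitions land.

CHEAPEST FALSIFIER. (1) The certified interlayer computation of item 0670: if |J₂| ≤
Σ_(k≥3)(k−1)|J_k| on the relaxed (a,h)-box, optimal stackings may be aperiodic and both cruxes 2–3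
die (uncertified margin ≈ 250–400 says they survive). (2) NoFoam: inspect putative LJ global minima
(Cambridge Cluster Database, N ≤ 1610; icosahedral/decahedral/fcc motifs) for internal voids of
radius ≥ 2 — none are reported, all are compact. (3) Junk audit of the typed rank-2 crux, done by
hand: the uniformly translated periodic law of Q satisfies hypotheses (a)–(d) iff e(Q) = e*, the
empty law fails (b), finite clusters fail (c) — no vacuous instance found.

NUMBERS. e(hcp) − e(fcc) ≈ −7.2e−5 and J₂ ≈ −7.25e−5, J₃ ≈ −8.5e−8 (route-internal numerics of
RefuteCrystalPeriodicMin / hull card, uncertified; certified version = item 0670); LJ bulk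
nearest-neighbour distance a* ≈ 0.971 (r₀ = 1 units); octahedral hole radius 0.707a* ≈ 0.69,
monovacancy hole radius a* ≈ 0.97 < 1, so already r₀ = 1 ignores point defects (NoFoam is stated
with ∃ r₀); minimal distance δ: LennardJonesMinimalDistance_holds (qualitative).

DEFINITION REQUESTS. None filed at open (inline typing, see Not decomposed yet). If grounders prefer
named notions: `Literature/Probability/PointProcess`: HardCoreCountingMeasure δ, IsStationaryLaw,
IsRelativelyDense r₀, ljPairEnergyOnBall, ChargesPeriodic — to be requested with `ledger workitem
add --kind definition` against the rank-2 item.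

Novelty: Searches (2026-08-15): lit search --hybrid "Benjamini-Schramm limit unimodular point process energy
minimizing stationary ground state crystallization" (12 book hits, none on point); lit vsearch
"translation invariant probability measure on configurations minimizing energy density, support on
periodic configurations, zero temperature Gibbs" (12 book hits: Friedli–Velenik, Lenard 1973,
Presutti 2009 — lattice/continuum Gibbs theory, no support-periodicity statement); lit search
--source zbmath "point processes minimizing energy" (15, irrelevant) and "stationary point process
energy minimizer crystallization" (0); --source s2 (2, irrelevant); openalex and arxiv APIs answered
HTTP 429 all session; lit galaxy search "energy-minimizing stationary point process" --star all (0)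
and "ground state measures" --star pdf (1, irrelevant); lit frontier/bridges AtomisticToContinuum
(kinetic-theory dominated, nothing on ground-state measures); lit read arxiv:1504.01153 --grep
'Palm|point process|unimodular|mass transport' (0 hits beyond the Leblé reference). Plus the refuter
novelty audit of the card (2026-08-15T04:26Z).
Nearest prior art found: AldousSteele2004 (objective method: root finite optimal configurations
uniformly, local weak limits satisfy mass transport, lim cost_N/N = E[cost at root]) with
AldousLyons2007 (unimodularity) and HevelingLast2005 / LastThorisson2009 (point-stationarity ⟺
Palm); Radin1991, Radin1987, RadinSchulman1983 (crystalline order as a property of ground-state  [refs: 1504.01153, arxiv:1504.01153, AldousSteele2004, AldousLyons2007, HevelingLast2005, LastThorisson2009, Radin1991, Radin1987, RadinSchulman1983, Leble2016, Lewin2022, BlancLewin2015]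

Barriers (technique_class: benjamini-schramm-limit, ground-state-measures, surgery): - technique_class: benjamini-schramm-limit, ground-state-measures, surgery
- Literature.Barriers.AtomisticToContinuum.AperiodicTilingGroundStates: APPLIES to any model-generic
form of the rank-2 crux (finite-range lattice gases with ground states but no periodic ground-state
configuration; Radin's two-species continuum example); evaded only because the crux is stated for
the Lennard-Jones pair potential alone and must be proved with LJ-specific input (hard-core local
structure + the r⁻⁶ tail selecting the stacking); the reformulation itself is barrier-neutral and
would correctly return "no periodic Q" for a Wang-tile gas.
- Literature.Barriers.AtomisticToContinuum.NoPeriodicGroundStateConfig: same answer — "local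
optimality ⇒ periodic" is never claimed generically; the conclusion is moreover only "a periodic Q
is CHARGED" (hull contains Q), robust to zero-density defects.
- Literature.Barriers.AtomisticToContinuum.SutoDegenerateGroundStates: not met — LJ is not
Fourier-positive/band-limited and the crux is at zero pressure (energy per particle), where by the
barrier's own scope caveat (d) no degenerate member is a minimiser; for a Sütő potential the
framework would return a face of minimisers containing periodic extreme points, so the
surgery-attainment half survives while uniqueness fails — exactly the potential-specific split.
- Literature.Barriers.AtomisticToContinuum.IcosahedralClusters: evaded — finite-cluster exactness is
never used; icosahedral LJ_13 / Mackay / decahed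

History (route lifecycle, newest last):
- 2026-08-15T13:41:08Z · CLOSED retired — not-a-thesis: assembly does not conclude the sub-problem Statement (operator:999:1257524)

sub-problem: Crystallization · status: closed(retired) · opened planner-plancard-AtomisticToContinuum-Crystal-e7276692-0 2026-08-15T11:09:24Z · rev 0 · ledger route-AtomisticToContinuum-BenjaminiSchrammGroundStates
GENERATED by the gate from the ledger (D-0016/17). Provers cite these decls: `theorem foo : Summit.AtomisticToContinuum.Crystallization.Theses.BenjaminiSchrammGroundStates.<Decl> := …` in Summits/AtomisticToContinuum/Crystallization/Theorems/<Name>.lean.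
-/

namespace Summit.AtomisticToContinuum.Crystallization.Theses.BenjaminiSchrammGroundStates

open scoped BigOperators Topology Manifold Classical MeasureTheory ProbabilityTheory Matrix InnerProductSpace ComplexConjugate ContinuousMap
open Filter Set Function TopologicalSpace MeasureTheory

attribute [summit_statement] _root_.Crystallization

/-- item stmt-AtomisticToContinuum-2910 · crux · rank 2 · closed · moot by None · by planner
why it might fail: Potential-generic versions are false (AperiodicTilingGroundStates; Radin 1986 two-species quasiperiodic minimisers; Sütő). For LJ an amorphous/polytetrahedral or aperiodically stacked stationary law reaching e* kills it; the stacking half rests on Hägg domination (J₂≈−7e−5, uncertified, item 0670).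
sources: Radin1991, RadinSchulman1983, Radin1987, BlancLewin2015, Lewin2022, Leble2016
[crux] (card item (iii)/A4, stationary form) for all δ₀, r₀ > 0 and every probability law P on
counting measures μ of ℝ³ that is (a) a.s. a sum of unit Dirac masses on a δ₀-separated set, (b)
a.s. r₀-relatively dense (every ball of radius r₀ contains a point), (c) translation invariant, and
(d) energy-minimal in the Campbell form E Σ_(x ∈ μ ∩ B̄(0,1)) Σ_(y ∈ μ, y ≠ x) V_LJ(|x − y|) = 2 · E
μ(B̄(0,1)) · ⨅_Q e(Q), there is a periodic configuration Q such that for all R, ε > 0, with positive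
P-probability some translate of μ is ε-matched both ways with Q on the ball of radius R. Ergodicity
is deliberately not assumed (equivalent modulo ergodic decomposition; the natural "defect density
costs energy" proofs work for stationary laws directly). [difficulty: open-problem] -/
@[route_item "route-AtomisticToContinuum-BenjaminiSchrammGroundStates"]
def StationaryMinimisersChargePeriodic : Prop :=
  ∀ δ₀ r₀ : ℝ, 0 < δ₀ → 0 < r₀ → ∀ P : MeasureTheory.Measure (MeasureTheory.Measure (EuclideanSpace ℝ (Fin 3))), MeasureTheory.IsProbabilityMeasure P → (∀ᵐ μ ∂P, ∃ S : Set (EuclideanSpace ℝ (Fin 3)), (∀ x ∈ S, ∀ y ∈ S, x ≠ y → δ₀ ≤ dist x y) ∧ μ = MeasureTheory.Measure.sum (fun s : S => MeasureTheory.Measure.dirac (s : EuclideanSpace ℝ (Fin 3)))) → (∀ᵐ μ ∂P, ∀ c : EuclideanSpace ℝ (Fin 3), ∃ y : EuclideanSpace ℝ (Fin 3), μ {y} ≠ 0 ∧ dist y c ≤ r₀) → (∀ (v : EuclideanSpace ℝ (Fin 3)) (A : Set (MeasureTheory.Measure (EuclideanSpace ℝ (Fin 3)))), MeasurableSet A →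 P {μ | μ.map (· + v) ∈ A} = P A) → (∫ μ, (∑' p : {p : EuclideanSpace ℝ (Fin 3) × EuclideanSpace ℝ (Fin 3) // μ {p.1} ≠ 0 ∧ μ {p.2} ≠ 0 ∧ p.1 ∈ Metric.closedBall (0 : EuclideanSpace ℝ (Fin 3)) 1 ∧ p.1 ≠ p.2}, Literature.MathematicalPhysics.StatisticalMechanics.lennardJones (dist p.1.1 p.1.2)) ∂P) = 2 * (∫ μ, (μ (Metric.closedBall (0 : EuclideanSpace ℝ (Fin 3)) 1)).toReal ∂P) * (⨅ Q : Literature.MathematicalPhysics.StatisticalMechanics.PeriodicConfiguration 3, Q.energyPerParticle Literature.MathematicalPhysics.StatisticalMechanics.lennardJones) → ∃ Q : Literature.MathematicalPhysics.StatisticalMechanics.PeriodicConfiguration 3, ∀ R ε : ℝ, 0 < R → 0 < ε → 0 < P {μ | ∃ v : EuclideanSpace ℝ (Fin 3), (∀ s ∈ Q.points, dist s 0 ≤ R → ∃ y : EuclideanSpace ℝ (Fin 3), μ {y} ≠ 0 ∧ dist y (s + v) ≤ ε) ∧ (∀ y : EuclideanSpace ℝ (Fin 3), μ {y} ≠ 0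 → dist y v ≤ R → ∃ s ∈ Q.points, dist y (s + v) ≤ ε)}

/-- item stmt-AtomisticToContinuum-2911 · crux · rank 3 · open · by planner
why it might fail: Needs ONE periodic Q charged with density ≥ρ(R,ε) at every scale for infinitely many N: fails if LJ bulk minimisers are aperiodic (Sturmian optimal Hägg words if domination fails, Hubbard-type staircases) or form a non-closed degenerate family (periods → ∞), or if ground states are foams.
sources: BlancLewin2015, FlatleyTheil2015, Radin1991, AldousSteele2004
[crux] (finite-N hinge; deterministic shadow of "the Benjamini–Schramm limit of the ground states
charges Q") for every sequence of LJ ground states x^N in ℝ³ there is ONE periodic configuration Q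
such that for all R, ε > 0 there is ρ > 0 with, for infinitely many N, at least ρN particles i whose
R-neighbourhood x^N ∩ B_R(x_i) is ε-matched both ways with x_i + A(Q.points − q) for some linear
isometry A and some base point q ∈ Q.points (base point in Q.points, not a fixed origin: no
vertex-transitivity is forced, cf. refuter note on 0751). Weaker than BulkDefectVanish 0751
(fraction → 1, fixed HCP): positive density, frequently in N, any periodic Q. [deps:
StationaryMinimisersChargePeriodic, NoFoam] [difficulty: XL] -/
@[route_item "route-AtomisticToContinuum-BenjaminiSchrammGroundStates"]
def GroundStatesChargePeriodic : Prop :=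
  ∀ x : (N : ℕ) → (Fin N → EuclideanSpace ℝ (Fin 3)), (∀ N, Literature.MathematicalPhysics.StatisticalMechanics.IsGroundState Literature.MathematicalPhysics.StatisticalMechanics.lennardJones (x N)) → ∃ Q : Literature.MathematicalPhysics.StatisticalMechanics.PeriodicConfiguration 3, ∀ R ε : ℝ, 0 < R → 0 < ε → ∃ ρ : ℝ, 0 < ρ ∧ ∃ᶠ N : ℕ in Filter.atTop, ρ * (N : ℝ) ≤ (Nat.card {i : Fin N // ∃ A : EuclideanSpace ℝ (Fin 3) →ₗᵢ[ℝ] EuclideanSpace ℝ (Fin 3), ∃ q ∈ Q.points, (∀ s ∈ Q.points, dist s q ≤ R → ∃ j : Fin N, dist (x N j) (x N i + A (s - q)) ≤ ε) ∧ (∀ j : Fin N, dist (x N j) (x N i) ≤ R → ∃ s ∈ Q.points, dist (x N j) (x N i + A (s - q)) ≤ ε)} : ℝ)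

/-- item stmt-AtomisticToContinuum-2912 · crux · rank 4 · closed · moot by None · by planner
why it might fail: Cohesion of LJ ground states is unproved beyond the minimal distance (BlancLewin2015 §2.2): not even diam x^N = O(N^(1/3)) is in print; a positive density of internal voids/cracks of width ≥ 2r₀ (sponge-like minimisers) breaks it; particle exchange only prices voids offering > |h_max| binding.
sources: BlancLewin2015, LastPenrose2017, HevelingLast2005, LastThorisson2009
[crux] (card item A1, cohesion) there is r₀ > 0 such that for every R > 0 and every sequence of LJ
ground states x^N, the fraction of particles i for which some point c with |c − x_i| ≤ R has no
particle within distance r₀ tends to 0 as N → ∞. Equivalently every Benjamini–Schramm limit is a.s.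
r₀-relatively dense (bounded Voronoi cells), hence the Palm law of a stationary process with
intensity ≥ 1/|B_(r₀)| — the one finite-N input of the line. Mechanism available: exchange of the
least-bound particle (site energy h_max) with a wall position of an interior void (site energy ≤
−k/12 for k contacts), plus deformation (closing a crack gains tail energy ∝ area). [difficulty: L] -/
@[route_item "route-AtomisticToContinuum-BenjaminiSchrammGroundStates"]
def NoFoam : Prop :=
  ∃ r₀ : ℝ, 0 < r₀ ∧ ∀ R : ℝ, 0 < R → ∀ x : (N : ℕ) → (Fin N → EuclideanSpace ℝ (Fin 3)), (∀ N, Literature.MathematicalPhysics.StatisticalMechanics.IsGroundState Literature.MathematicalPhysics.StatisticalMechanics.lennardJones (x N)) → Filter.Tendsto (fun N : ℕ => (Nat.card {i : Fin N // ∃ c : EuclideanSpace ℝ (Fin 3), dist c (x N i) ≤ R ∧ ∀ j : Fin N, r₀ ≤ dist c (x N j)} : ℝ) / N) Filter.atTop (nhds 0)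

/-- item stmt-AtomisticToContinuum-0626 · support · rank 9 · open · by planner
sources: BlancLewin2015
Energetic crystallization: E(N)/N converges to the infimum over periodic (multi-lattice)
configurations of the LJ energy per particle in d = 3. Lower bound liminf ≥ ⨅ is the content ((a)
local optimality + (d) + surface term O(N^{2/3})); upper bound is filed separately. -/
@[route_item "route-AtomisticToContinuum-BenjaminiSchrammGroundStates"]
def CrysEnergyLimit : Prop :=
  Filter.Tendsto (fun N : ℕ => Literature.MathematicalPhysics.StatisticalMechanics.groundStateEnergy Literature.MathematicalPhysics.StatisticalMechanics.lennardJones 3 N / N) Filter.atTop (nhds (⨅ Q : Literature.MathematicalPhysics.StatisticalMechanics.PeriodicConfiguration 3, Q.energyPerParticle Literature.MathematicalPhysics.StatisticalMechanics.lennardJones))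

/-- item stmt-AtomisticToContinuum-2913 · support · rank 9 · open · by planner
sources: BlancLewin2015, AldousSteele2004
[support] (card item A3, SURGERY-ATTAINMENT; conjunct (i) from a support statement) if a periodic
configuration Q is charged by some sequence of LJ ground states with positive density at every scale
(the conclusion of GroundStatesChargePeriodic for this Q), then e(Q) is the least value of the
energy per particle over all periodic configurations. Proof sketch: if e(Q') < e(Q), pick R ≫
1/(e(Q) − e(Q')) and ε small; along the infinitely many N with ≥ ρN good particles select ≥ ρN/(C
R³) disjoint good R-balls (hard-core packing bound, in tree), excise each patch (n ≈ |Q ∩ B_R|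
particles, self-energy ≥ n e(Q) − Cεn − CR², cross terms ≥ −CR² by the r⁻⁶ tail and
LennardJonesMinimalDistance) and insert a Q'-patch of radius R − 1 with n' ≤ n particles (margin 1 ⇒
all new cross terms ≤ 0); compare E(N') ≤ E_mod with E(M)/M → e_∞ (BlancLewin2015_8_holds, proved)
and e_∞ ≤ e(Q') (trial states, 0629): 0 ≤ k[(n' − n)(e(Q') − e_∞) − n(e(Q) − e(Q')) + CR² + Cεn] +
o(N) with k ≥ cρN/R³ is absurd for R large. No Wulff shapes, no rates. [difficulty: M] -/
@[route_item "route-AtomisticToContinuum-BenjaminiSchrammGroundStates"]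
def ChargedPeriodicIsOptimal : Prop :=
  ∀ Q : Literature.MathematicalPhysics.StatisticalMechanics.PeriodicConfiguration 3, (∃ x : (N : ℕ) → (Fin N → EuclideanSpace ℝ (Fin 3)), (∀ N, Literature.MathematicalPhysics.StatisticalMechanics.IsGroundState Literature.MathematicalPhysics.StatisticalMechanics.lennardJones (x N)) ∧ ∀ R ε : ℝ, 0 < R → 0 < ε → ∃ ρ : ℝ, 0 < ρ ∧ ∃ᶠ N : ℕ in Filter.atTop, ρ * (N : ℝ) ≤ (Nat.card {i : Fin N // ∃ A : EuclideanSpace ℝ (Fin 3) →ₗᵢ[ℝ] EuclideanSpace ℝ (Fin 3), ∃ q ∈ Q.points, (∀ s ∈ Q.points, dist s q ≤ R → ∃ j : Fin N, dist (x N j) (x N i + A (s - q)) ≤ ε) ∧ (∀ j : Fin N, dist (x N j) (x N i) ≤ R → ∃ s ∈ Q.points, dist (x N j) (x N i + A (s - q)) ≤ ε)} : ℝ)) → IsLeast (Set.range fun Q' : Literature.MathematicalPhysics.StatisticalMechanics.PeriodicConfiguration 3 => Q'.energyPerParticle Literature.MathematicalPhysics.StatisticalMechanics.lennardJones) (Q.energyPerParticle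 Literature.MathematicalPhysics.StatisticalMechanics.lennardJones)

/-- item stmt-AtomisticToContinuum-2914 · support · rank 9 · closed · moot by None · by planner
sources: BlancLewin2015, Leble2016, Lewin2022
[support] (card item A2, e_uni = e*: infinite-volume periodisation) for every δ₀ > 0 and every
translation-invariant probability law P on δ₀-hard-core counting measures of ℝ³: 2 · E μ(B̄(0,1)) ·
⨅_Q e(Q) ≤ E Σ_(x ∈ μ ∩ B̄(0,1)) Σ_(y ≠ x) V_LJ(|x − y|), i.e. no stationary law has energy per
particle below the periodic infimum (periodise the content of a large randomly placed box with a
unit empty margin, as in 0715; boundary O(L²) against volume by Campbell). This is what makes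
hypothesis (d) of the rank-2 crux a MINIMALITY statement; used by its provers, not by the assembly.
[difficulty: M] -/
@[route_item "route-AtomisticToContinuum-BenjaminiSchrammGroundStates"]
def NoStationaryBeatsPeriodic : Prop :=
  ∀ δ₀ : ℝ, 0 < δ₀ → ∀ P : MeasureTheory.Measure (MeasureTheory.Measure (EuclideanSpace ℝ (Fin 3))), MeasureTheory.IsProbabilityMeasure P → (∀ᵐ μ ∂P, ∃ S : Set (EuclideanSpace ℝ (Fin 3)), (∀ x ∈ S, ∀ y ∈ S, x ≠ y → δ₀ ≤ dist x y) ∧ μ = MeasureTheory.Measure.sum (fun s : S => MeasureTheory.Measure.dirac (s : EuclideanSpace ℝ (Fin 3)))) → (∀ (v : EuclideanSpace ℝ (Fin 3)) (A : Set (MeasureTheory.Measure (EuclideanSpace ℝ (Fin 3)))), MeasurableSet A → P {μ | μ.map (· + v) ∈ A} = P A) → 2 * (∫ μ, (μ (Metric.closedBall (0 : EuclideanSpace ℝ (Fin 3)) 1)).toReal ∂P) * (⨅ Q : Literature.MathematicalPhysics.StatisticalMechanics.PeriodicConfiguration 3, Q.energyPerParticle Literature.MathematicalPhysics.StatisticalMechanics.lennardJones)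 ≤ ∫ μ, (∑' p : {p : EuclideanSpace ℝ (Fin 3) × EuclideanSpace ℝ (Fin 3) // μ {p.1} ≠ 0 ∧ μ {p.2} ≠ 0 ∧ p.1 ∈ Metric.closedBall (0 : EuclideanSpace ℝ (Fin 3)) 1 ∧ p.1 ≠ p.2}, Literature.MathematicalPhysics.StatisticalMechanics.lennardJones (dist p.1.1 p.1.2)) ∂P

/-- item stmt-AtomisticToContinuum-2915 · support · rank 9 · closed · moot by None · by planner
sources: AldousLyons2007, AldousSteele2004, BenjaminiSchramm1996, HevelingLast2005, LastThorisson2009, LastPenrose2017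
[support] (the Benjamini–Schramm framework, glue of the foreseen split of
GroundStatesChargePeriodic) StationaryMinimisersChargePeriodic → NoFoam → (E(N)/N → ⨅_Q e(Q)) →
GroundStatesChargePeriodic. Proof sketch: rooted empirical fields P_N = N⁻¹ Σ_i δ_(x^N − x_i) as
laws on counting measures; hard core δ (LennardJonesMinimalDistance_holds) ⇒ tightness/compactness
in the vague topology; h(μ) = ½ Σ_(y ≠ 0) V(|y|) is bounded continuous there, so E_P[h] = lim
E(N_j)/N_j = ⨅ e for every subsequential limit P; P is point-stationary (mass transport holds
identically at finite N); NoFoam ⇒ P-a.s. r₀-dense ⇒ Palm inversion gives a stationary probability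
law with the hypotheses (a)–(d) of the rank-2 crux (Campbell); its charged Q has P_(N_j)-frequency ≥
ρ for j large (portmanteau on open pattern events), which is the hinge. [glue] [difficulty: L] -/
@[route_item "route-AtomisticToContinuum-BenjaminiSchrammGroundStates"]
def BSLimitGlue : Prop :=
  StationaryMinimisersChargePeriodic → NoFoam → Filter.Tendsto (fun N : ℕ => Literature.MathematicalPhysics.StatisticalMechanics.groundStateEnergy Literature.MathematicalPhysics.StatisticalMechanics.lennardJones 3 N / N) Filter.atTop (nhds (⨅ Q : Literature.MathematicalPhysics.StatisticalMechanics.PeriodicConfiguration 3, Q.energyPerParticle Literature.MathematicalPhysics.StatisticalMechanics.lennardJones)) → GroundStatesChargePeriodic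

/-- item stmt-AtomisticToContinuum-2916 · support · rank 9 · open · by planner
sources: BlancLewin2015
[support] (soft) GroundStatesChargePeriodic → LennardJonesMinimalDistance → IsCrystallizing
lennardJones 3: choose scales (k, 1/k), indices N_k ↑ with a good particle i_k, isometries A_k → A
along a subsequence (compactness of O(3)), τ_k := −x_(i_k) + alignment; the two-way matching with
minimal distance is eventually exact near every compact set, so
PeriodicConfiguration.tendsto_sum_of_eventually_near' (in tree) gives local convergence to the
periodic configuration A(Q − q) (isometryImage/translate in CrystallizationSymmetries), multiplicity
1. [difficulty: M] -/
@[route_item "route-AtomisticToContinuum-BenjaminiSchrammGroundStates"]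
def ChargedPatternCrystallizes : Prop :=
  GroundStatesChargePeriodic → Literature.MathematicalPhysics.StatisticalMechanics.LennardJonesMinimalDistance → Literature.MathematicalPhysics.StatisticalMechanics.IsCrystallizing Literature.MathematicalPhysics.StatisticalMechanics.lennardJones 3

/-- item stmt-AtomisticToContinuum-2917 · assembly · rank 1 · closed · moot by None · by planner
sources: BlancLewin2015
[assembly] StationaryMinimisersChargePeriodic → NoFoam → ChargedPeriodicIsOptimal → BSLimitGlue →
ChargedPatternCrystallizes → (E(N)/N → ⨅_Q e(Q)) → Crystallization. -/
@[route_item "route-AtomisticToContinuum-BenjaminiSchrammGroundStates"]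
def Assembly : Prop :=
  StationaryMinimisersChargePeriodic → NoFoam → ChargedPeriodicIsOptimal → BSLimitGlue → ChargedPatternCrystallizes → Filter.Tendsto (fun N : ℕ => Literature.MathematicalPhysics.StatisticalMechanics.groundStateEnergy Literature.MathematicalPhysics.StatisticalMechanics.lennardJones 3 N / N) Filter.atTop (nhds (⨅ Q : Literature.MathematicalPhysics.StatisticalMechanics.PeriodicConfiguration 3, Q.energyPerParticle Literature.MathematicalPhysics.StatisticalMechanics.lennardJones)) → Literature.MathematicalPhysics.StatisticalMechanics.Crystallization

end Summit.AtomisticToContinuum.Crystallization.Theses.BenjaminiSchrammGroundStates
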